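import Literature.Analysis.FluidPDE.FluidComputer.ReachCertificate
import HarnessLib

/-!
# Fluid computer blueprint — composing STAGE certificates into a cycle certificate

HONEST FRAMING: low prior, high value-of-information experiment on Tao's machine paradigm; NOT a
claim that NS blows up. Everything in this file is elementary bookkeeping about the reach layer's
interface `ReachCertificate` (`ReachCertificate.lean`); nothing is asserted about any fluid
equation, and nothing about any particular gate.

## Why

A gate's cycle is certified in STAGES (for the threshold gate of `ThresholdGate.lean`: quiet
clocking up to the threshold — in tree as a `ReachCertificate` whose output region is the
ignition-ready hand-off box; ignition — a theorem; rotor transfer and drain — open). The reach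
layer consumes ONE certificate per cycle (`ReachCircuit.withCertificate`). This file supplies the
missing glue: two certificates for the same design field `F`, working region `U` and defect `ε`,
of lengths `τ₁` and `τ₂`, the first handing its end-of-stage tube `Tube₁ p τ₁` into the input
region of the second, compose to a certificate of length `τ₁ + τ₂` from the first input region to
the second output region (`ReachCertificate.comp`).

## The one non-trivial point

The interface asks for a tube with CLOSED GRAPH. The composite tube after the seam is the union
over the hand-off states `q ∈ Tube₁ p τ₁` of the second-stage tubes `Tube₂ q (σ - τ₁)` — a
projection along `q`; projections of closed sets are closed along a COMPACT factor. Hence the two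
hypotheses of `comp` beyond the hand-off inclusion: the hand-off tube `Tube₁ p τ₁` is compact, and
the second certificate's graph is closed JOINTLY in `(q, σ, X)` over it (`isClosed_snd_image_of_
isCompact`, `isClosed_compTube_graph`). Both hold for tubes cut out by finitely many inequalities
continuous in all variables on a finite-dimensional mode space, which is the only case the
blueprint uses. The curve half of the composition is a time shift (`hasDerivWithinAt_comp_add_
right`): the second stage is run on `u ↦ x (u + τ₁)`.
[cite: Tao2016AveragedNS, §5.5 (the three phases of Thm 5.3); §1.3 pp. 10–11]
-/

noncomputable section

open Set Filter Topology
open scoped NNReal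

namespace Literature.Analysis.FluidPDE.FluidComputer

variable {O : Type*} [NormedAddCommGroup O] [NormedSpace ℝ O]

/-! ### §1. Two topological and one calculus helper -/

omit [NormedSpace ℝ O] in
/-- Projection along a compact factor is closed: if `S ⊆ K × (anything)` is closed and `K` is
compact then `Prod.snd '' S` is closed. [folklore] -/
theorem isClosed_snd_image_of_isCompact {Y : Type*} [TopologicalSpace Y] {K : Set O}
    (hK : IsCompact K) {S : Set (O × Y)} (hS : IsClosed S) (hSK : ∀ z ∈ S, z.1 ∈ K) :
    IsClosed (Prod.snd '' S) := by
  haveI : CompactSpace K := isCompact_iff_compactSpace.mp hK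
  let ι : K × Y → O × Y := fun z => ((z.1 : O), z.2)
  have hι : Continuous ι := by fun_prop
  have hS' : IsClosed (ι ⁻¹' S) := hS.preimage hι
  have himg : Prod.snd '' (ι ⁻¹' S) = Prod.snd '' S := by
    ext w
    constructor
    · rintro ⟨z, hz, rfl⟩
      exact ⟨ι z, hz, rfl⟩
    · rintro ⟨z, hz, rfl⟩
      refine ⟨(⟨z.1, hSK z hz⟩, z.2), ?_, rfl⟩
      show ((z.1 : O), z.2) ∈ S
      simpa using hz
  rw [← himg]
  exact isClosedMap_snd_of_compactSpace _ hS'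

/-- Time shift of a right derivative: if `x` has right derivative `W` at `u + τ` then
`u ↦ x (u + τ)` has right derivative `W` at `u`. [folklore] -/
theorem hasDerivWithinAt_comp_add_right (x : ℝ → O) {W : O} {τ u : ℝ}
    (h : HasDerivWithinAt x W (Ici (u + τ)) (u + τ)) :
    HasDerivWithinAt (fun v => x (v + τ)) W (Ici u) u := by
  have hg : HasDerivWithinAt (fun v : ℝ => v + τ) 1 (Ici u) u :=
    (hasDerivWithinAt_id u (Ici u)).add_const τ
  have hmaps : MapsTo (fun v : ℝ => v + τ) (Ici u) (Ici (u + τ)) := by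
    intro v hv
    simp only [mem_Ici] at hv ⊢
    linarith
  have := h.scomp u hg hmaps
  simpa [Function.comp_def] using this

namespace ReachCertificate

variable {F : O → O} {U : Set O} {ε τ₁ τ₂ : ℝ} {Ain Amid Aout : Set O}

/-! ### §2. The composite tube -/

/-- **The composite tube**: the first-stage tube up to the seam `σ = τ₁`, and from the seam on the
union over the hand-off states `q ∈ Tube₁ p τ₁` of the second-stage tubes `Tube₂ q (σ - τ₁)`
(at the seam itself both parts are present). [folklore] -/
def compTube (C₁ : ReachCertificate F U ε τ₁ Ain Amid) (C₂ : ReachCertificate F U ε τ₂ Amid Aout)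
    (p : O) (σ : ℝ) : Set O :=
  {X | σ ≤ τ₁ ∧ X ∈ C₁.Tube p σ} ∪ {X | τ₁ ≤ σ ∧ ∃ q ∈ C₁.Tube p τ₁, X ∈ C₂.Tube q (σ - τ₁)}

/-- **Closed graph of the composite tube** over `[0, τ₁ + τ₂]`, from the first certificate's closed
graph, compactness of the hand-off tube and JOINT closedness of the second certificate's graph
over it. [folklore] -/
theorem isClosed_compTube_graph (C₁ : ReachCertificate F U ε τ₁ Ain Amid)
    (C₂ : ReachCertificate F U ε τ₂ Amid Aout) (hτ₁ : 0 ≤ τ₁) (hτ₂ : 0 ≤ τ₂) {p : O}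
    (hp : p ∈ Ain) (hK : IsCompact (C₁.Tube p τ₁))
    (hjoint : IsClosed {z : O × (ℝ × O) |
      z.1 ∈ C₁.Tube p τ₁ ∧ z.2.1 ∈ Icc 0 τ₂ ∧ z.2.2 ∈ C₂.Tube z.1 z.2.1}) :
    IsClosed {z : ℝ × O | z.1 ∈ Icc 0 (τ₁ + τ₂) ∧ z.2 ∈ compTube C₁ C₂ p z.1} := by
  have hG1 := C₁.Tube_closed p hp
  -- the post-seam part, in the cycle's own time coordinate, as a projection along `q`
  let S : Set (O × (ℝ × O)) :=
    {z | z.1 ∈ C₁.Tube p τ₁ ∧ z.2.1 - τ₁ ∈ Icc 0 τ₂ ∧ z.2.2 ∈ C₂.Tube z.1 (z.2.1 - τ₁)}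
  have hS : IsClosed S := by
    have hφ : Continuous fun z : O × (ℝ × O) => (z.1, (z.2.1 - τ₁, z.2.2)) := by fun_prop
    exact hjoint.preimage hφ
  have hG2 : IsClosed (Prod.snd '' S) := isClosed_snd_image_of_isCompact hK hS fun z hz => hz.1
  have heq : {z : ℝ × O | z.1 ∈ Icc 0 (τ₁ + τ₂) ∧ z.2 ∈ compTube C₁ C₂ p z.1} =
      {z : ℝ × O | z.1 ∈ Icc 0 τ₁ ∧ z.2 ∈ C₁.Tube p z.1} ∪ Prod.snd '' S := by
    ext z
    constructor
    · rintro ⟨hz, hmem⟩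
      rcases hmem with ⟨hle, hX⟩ | ⟨hge, q, hq, hX⟩
      · exact Or.inl ⟨⟨hz.1, hle⟩, hX⟩
      · refine Or.inr ⟨(q, z), ⟨hq, ⟨?_, ?_⟩, hX⟩, rfl⟩
        · show 0 ≤ z.1 - τ₁
          linarith
        · show z.1 - τ₁ ≤ τ₂
          linarith [hz.2]
    · rintro (⟨hz, hX⟩ | ⟨w, hw, rfl⟩)
      · exact ⟨⟨hz.1, by linarith [hz.2]⟩, Or.inl ⟨hz.2, hX⟩⟩
      · obtain ⟨hw1, ⟨hw2, hw3⟩, hw4⟩ := hw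
        exact ⟨⟨by linarith, by linarith⟩, Or.inr ⟨by linarith, w.1, hw1, hw4⟩⟩
  rw [heq]
  exact hG1.union hG2

/-! ### §3. Composition -/

/-- **Composition of stage certificates.** Two robust reach–avoid certificates for the same design
field, working region and defect level — the first of length `τ₁ ≥ 0` from `Ain` handing its
end-of-stage tube into `Amid`, the second of length `τ₂ > 0` from `Amid` to `Aout` — compose to a
certificate of length `τ₁ + τ₂` from `Ain` to `Aout`, provided the hand-off tubes are compact and
the second graph is jointly closed over them (see the module docstring). The curve half: run the
first certificate on `[0, min σT τ₁]`, then the second on the time-shifted curve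
`u ↦ x (u + τ₁)`; REACH at full cycle is the second stage's REACH. [folklore] -/
def comp (C₁ : ReachCertificate F U ε τ₁ Ain Amid) (C₂ : ReachCertificate F U ε τ₂ Amid Aout)
    (hτ₁ : 0 ≤ τ₁) (hτ₂ : 0 < τ₂) (hand : ∀ p ∈ Ain, C₁.Tube p τ₁ ⊆ Amid)
    (hK : ∀ p ∈ Ain, IsCompact (C₁.Tube p τ₁))
    (hjoint : ∀ p ∈ Ain, IsClosed {z : O × (ℝ × O) |
      z.1 ∈ C₁.Tube p τ₁ ∧ z.2.1 ∈ Icc 0 τ₂ ∧ z.2.2 ∈ C₂.Tube z.1 z.2.1}) :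
    ReachCertificate F U ε (τ₁ + τ₂) Ain Aout where
  Tube := compTube C₁ C₂
  Tube_closed p hp := isClosed_compTube_graph C₁ C₂ hτ₁ hτ₂.le hp (hK p hp) (hjoint p hp)
  Tube_zero p hp := Or.inl ⟨hτ₁, C₁.Tube_zero p hp⟩
  Tube_sub p hp σ hσ := by
    rintro X (⟨hσ1, hX⟩ | ⟨hσ1, q, hq, hX⟩)
    · exact C₁.Tube_sub p hp σ ⟨hσ.1, hσ1⟩ hX
    · exact C₂.Tube_sub q (hand p hp hq) (σ - τ₁) ⟨by linarith, by linarith [hσ.2]⟩ hX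
  cert p hp σT x h0 hσT hx0 hcont hU hder := by
    by_cases hle : σT ≤ τ₁
    · -- the whole window lies in the first stage
      obtain ⟨hm, -⟩ := C₁.cert p hp σT x h0 hle hx0 hcont hU hder
      exact ⟨Or.inl ⟨hle, hm⟩, fun hEq => absurd hle (by linarith)⟩
    · rw [not_le] at hle
      -- first stage on `[0, τ₁]`
      obtain ⟨hm1, -⟩ := C₁.cert p hp τ₁ x hτ₁ le_rfl hx0
        (hcont.mono (Icc_subset_Icc_right hle.le))
        (fun σ hσ => hU σ ⟨hσ.1, hσ.2.trans hle⟩)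
        (fun σ hσ => hder σ ⟨hσ.1, hσ.2.trans hle⟩)
      have hq : x τ₁ ∈ Amid := hand p hp hm1
      -- second stage on the shifted curve
      have hycont : ContinuousOn (fun u => x (u + τ₁)) (Icc 0 (σT - τ₁)) := by
        refine hcont.comp (by fun_prop : Continuous fun u : ℝ => u + τ₁).continuousOn ?_
        intro u hu
        exact ⟨by linarith [hu.1], by linarith [hu.2]⟩
      have hyU : ∀ u ∈ Ico 0 (σT - τ₁), x (u + τ₁) ∈ U :=
        fun u hu => hU (u + τ₁) ⟨by linarith [hu.1], by linarith [hu.2]⟩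
      have hyder : ∀ u ∈ Ico 0 (σT - τ₁), ∃ W : O,
          HasDerivWithinAt (fun v => x (v + τ₁)) W (Ici u) u ∧ ‖W - F (x (u + τ₁))‖ ≤ ε := by
        intro u hu
        obtain ⟨W, hW, hWF⟩ := hder (u + τ₁) ⟨by linarith [hu.1], by linarith [hu.2]⟩
        exact ⟨W, hasDerivWithinAt_comp_add_right x hW, hWF⟩
      obtain ⟨hm2, hr2⟩ := C₂.cert (x τ₁) hq (σT - τ₁) (fun u => x (u + τ₁)) (by linarith)
        (by linarith) (by simp) hycont hyU hyder
      refine ⟨Or.inr ⟨hle.le, x τ₁, hm1, by simpa using hm2⟩, fun hEq => ?_⟩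
      obtain ⟨s, hs, hsA⟩ := hr2 (by linarith)
      exact ⟨s + τ₁, ⟨by linarith [hs.1], by linarith [hs.2]⟩, by simpa using hsA⟩

/-- Unfolding the composite tube before the seam. [folklore] -/
theorem comp_tube_of_le (C₁ : ReachCertificate F U ε τ₁ Ain Amid)
    (C₂ : ReachCertificate F U ε τ₂ Amid Aout) (hτ₁ : 0 ≤ τ₁) (hτ₂ : 0 < τ₂)
    (hand : ∀ p ∈ Ain, C₁.Tube p τ₁ ⊆ Amid) (hK : ∀ p ∈ Ain, IsCompact (C₁.Tube p τ₁))
    (hjoint : ∀ p ∈ Ain, IsClosed {z : O × (ℝ × O) |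
      z.1 ∈ C₁.Tube p τ₁ ∧ z.2.1 ∈ Icc 0 τ₂ ∧ z.2.2 ∈ C₂.Tube z.1 z.2.1})
    (p : O) {σ : ℝ} (hσ : σ < τ₁) :
    (C₁.comp C₂ hτ₁ hτ₂ hand hK hjoint).Tube p σ = C₁.Tube p σ := by
  ext X
  show X ∈ compTube C₁ C₂ p σ ↔ _
  simp only [compTube, Set.mem_union, Set.mem_setOf_eq]
  constructor
  · rintro (⟨-, hX⟩ | ⟨hge, -⟩)
    · exact hX
    · exact absurd hge (not_le.mpr hσ)
  · exact fun hX => Or.inl ⟨hσ.le, hX⟩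

/-- Unfolding the composite tube after the seam. [folklore] -/
theorem comp_tube_of_lt (C₁ : ReachCertificate F U ε τ₁ Ain Amid)
    (C₂ : ReachCertificate F U ε τ₂ Amid Aout) (hτ₁ : 0 ≤ τ₁) (hτ₂ : 0 < τ₂)
    (hand : ∀ p ∈ Ain, C₁.Tube p τ₁ ⊆ Amid) (hK : ∀ p ∈ Ain, IsCompact (C₁.Tube p τ₁))
    (hjoint : ∀ p ∈ Ain, IsClosed {z : O × (ℝ × O) |
      z.1 ∈ C₁.Tube p τ₁ ∧ z.2.1 ∈ Icc 0 τ₂ ∧ z.2.2 ∈ C₂.Tube z.1 z.2.1})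
    (p : O) {σ : ℝ} (hσ : τ₁ < σ) :
    (C₁.comp C₂ hτ₁ hτ₂ hand hK hjoint).Tube p σ =
      {X | ∃ q ∈ C₁.Tube p τ₁, X ∈ C₂.Tube q (σ - τ₁)} := by
  ext X
  show X ∈ compTube C₁ C₂ p σ ↔ _
  simp only [compTube, Set.mem_union, Set.mem_setOf_eq]
  constructor
  · rintro (⟨hle, -⟩ | ⟨-, hX⟩)
    · exact absurd hle (not_le.mpr hσ)
    · exact hX
  · exact fun hX => Or.inr ⟨hσ.le, hX⟩

end ReachCertificate

end Literature.Analysis.FluidPDE.FluidComputer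

end
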